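import Mathlib
import Summits.Ventures.PercRepro2.SwOutCrossDefs

/-!
# The slab injection of the cross-arm cube (blind cell PercRepro2, night-4 g23, 2026-08-28;
proofs/NIGHT4-G23.md §6)

The non-core points of the T-slab (all u-arms red) carry `EB = ∅`, those of the B-slab `ER = ∅`;
the inequality needs an injection of the former into the latter with `ER ⊆ EB` that does not
leave an up-set of types.  `Fib.psi` is that injection on the fibre (twelve points to twelve
points, found by matching and checked here by `decide`): it keeps the attachment data inside the
blue side of the image and improves the label.
-/

namespace Summit.Ventures.PercRepro2

namespace CrossArm

/-- The slab injection on the fibre: the twelve non-core non-leaking points of the T-slab to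
twelve non-core non-leaking points of the B-slab (identity elsewhere). -/
def Fib.psi (w : Fib) : Fib :=
  match w with
  | ⟨false, false, false, false, true⟩ => ⟨true, true, true, false, true⟩
  | ⟨false, false, false, true, false⟩ => ⟨true, true, true, true, false⟩
  | ⟨false, false, false, true, true⟩ => ⟨true, true, true, false, false⟩
  | ⟨false, false, true, false, true⟩ => ⟨true, true, false, false, false⟩
  | ⟨false, false, true, true, false⟩ => ⟨true, true, false, true, false⟩
  | ⟨false, false, true, true, true⟩ => ⟨true, true, false, false, true⟩
  | ⟨false, true, false, false, true⟩ => ⟨true, false, true, false, false⟩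
  | ⟨false, true, false, true, true⟩ => ⟨true, false, true, true, false⟩
  | ⟨false, true, true, true, true⟩ => ⟨true, false, false, false, false⟩
  | ⟨true, false, false, true, false⟩ => ⟨false, true, true, false, false⟩
  | ⟨true, false, false, true, true⟩ => ⟨false, true, true, false, true⟩
  | ⟨true, false, true, true, true⟩ => ⟨false, true, false, false, false⟩
  | w => w

/-- **The slab injection**: on a non-core fibre point without red-side leak, the image has no
blue-side leak, is not core, has a better label, and its flip carries the attachment data of the
source (so `ER ⊆ EB` on the slabs). -/
lemma Fib.psi_ok : ∀ w : Fib, w.LeakR = false → w.Core = false →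
    w.psi.LeakB = false ∧ w.psi.Core = false ∧ Label.Better w.psi.label w.label ∧
      (w.att₁ = true → w.psi.flip.att₁ = true) ∧ (w.att₂ = true → w.psi.flip.att₂ = true) ∧
      (w.attC = true → w.psi.flip.attC = true) := by
  decide

/-- The slab injection is injective on the non-core points without red-side leak. -/
lemma Fib.psi_inj : ∀ w w' : Fib, w.LeakR = false → w.Core = false → w'.LeakR = false →
    w'.Core = false → w.psi = w'.psi → w = w' := by
  decide

end CrossArm

end Summit.Ventures.PercRepro2
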